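import Summits.BirchSwinnertonDyer.BirchSwinnertonDyer.Theorems.EisensteinPrimesMazurMCOnCellBTwistbackPartnerClassNumber
import HarnessLib

/-!
# `‖B₁^{(d)}(ω̃ ∘ ψ̄)‖_p = ‖h(−d)‖_p` keyed on Greenberg–Vatsal's `𝔽_p`-valued character ALONE:
# the complex avatar of a quadratic-valued Dirichlet character (THEOREMS; curve-free, fact-free)

HONEST FRAMING (cell `bsd-eis`, width seat `bsd-line-x2-p1-w3` gen 7 on crux 3 `MazurMCOnCellB` =
stmt-BirchSwinnertonDyer-19033, line `twistback` v4, LEAD `bsd-line-x2-p1` g10; programme D-0033).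
Theorems only: no definition, no named fact, no `sorry`; nothing booked; no label / cell / stub / tier
moves; no summit statement, main conjecture or case of BSD is proved. SEQUEL of
`…TwistbackPartnerClassNumber` (this seat, (1)), whose headline
`norm_twistedBernoulli_teichmullerLift_inv_eq_norm_classNumber` takes, next to GV's character
`ψ : DirichletCharacter (ZMod p) d` (`𝔽_p`-valued, as in the tree's typing of GV Thm. (3.11),
`thm311_hasUnitContent_iff_and_order_eq_of_lineRamifiedEven`), an odd primitive quadratic COMPLEX
character `χ` mod `d` with the same sign pattern. Here that complex character is PRODUCED from `ψ`:

* §1 `exists_complex_avatar`: for `p ≠ 2` and a quadratic-valued `ψ : DirichletCharacter (ZMod p) d`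
  (`MulChar.IsQuadratic`: values in `{0, ±1}` — automatic at `p = 3`, `isQuadratic_of_zmod_three`)
  there are a quadratic `χ : DirichletCharacter ℂ d` and a sign pattern `F : ℕ → ℤ` with
  `χ(b) = F(b)`, `ψ(b) = F(b) mod p` for every `b`, **the same conductor** (`χ.conductor = ψ.conductor`,
  so `χ` is primitive iff `ψ` is) and **the same parity** (`ψ` odd ⇒ `χ` odd, `ψ` even ⇒ `χ` even).
  Construction inside the proof (no definition is introduced): `χ = MulChar.ofUnitHom f`,
  `f(u) = if ψ(u) = 1 then 1 else −1 ∈ ℂˣ`; the conductors agree because both are read off the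
  common kernel `{u : ψ(u) = 1}` (Mathlib `factorsThrough_iff_ker_unitsMap`).
* §2 HEADLINES keyed on `ψ` alone (`p ≠ 2`, `d > 4`, `ψ` primitive, odd, quadratic-valued):
  **`norm_twistedBernoulli_teichmullerLift_inv_eq_norm_classNumber_of_isPrimitive`**:
  `‖twistedBernoulli p 1 d (ω̃ ∘ ψ⁻¹)‖_p = ‖h(−d)‖_p` (`h(−d)` = `BinaryQuadraticForm.classNumber (−d)`),
  the `C`-side shape without `⁻¹`, `= 1 ↔ p ∤ h(−d)`, the field form `= ‖h_K‖_p` for every `K` with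
  `[K : ℚ] = 2`, `d_K = −d`, and `exists_quadraticField_discr_eq_neg` (such a `K` exists: `−d` is a
  fundamental discriminant); the `p = 3` specialisations drop the quadratic-valued hypothesis.
* §3 `λ = 0` from a class number, keyed on `ψ` alone: `ψ(p) ≠ 1` ∧ unit Euler indicators ∧
  `p ∤ h(−d)` ⟹ `ord_T(L_{Σ₀}(D, T) mod p) = 0` and the `C`-twin (sibling certificates p643262).

References: [GreenbergVatsal2000] §2 p. 28 («we view both `φ` and `ψ` as having values in `ℤ_pˣ`»),
§3 pp. 41–42 ((26), (27)); [Washington1997] Thm. 4.17; [MontgomeryVaughan2007] §9.3 Thm. 9.13 (real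
primitive characters ↔ fundamental discriminants); [Cox2013] Thm. 2.13, Thm. 7.7 (ii).
-/

set_option autoImplicit false
set_option linter.dupNamespace false -- disclosed: the `…BirchSwinnertonDyer.BirchSwinnertonDyer…` namespace

noncomputable section

open scoped Classical

open Finset NumberField IsDedekindDomain DirichletCharacter
  Literature.NumberTheory.QuadraticFields
  Literature.NumberTheory.EllipticCurves
  Literature.NumberTheory.EllipticCurves.GreenbergVatsal2000
  Summit.BirchSwinnertonDyer.BirchSwinnertonDyer.Theorems.EisensteinPrimesMazurMCOnCellBTwistbackPartnerTrivialZero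
  Summit.BirchSwinnertonDyer.BirchSwinnertonDyer.Theorems.EisensteinPrimesMazurMCOnCellBTwistbackPartnerClassNumber

namespace Summit.BirchSwinnertonDyer.BirchSwinnertonDyer.Theorems.EisensteinPrimesMazurMCOnCellBTwistbackPartnerClassNumberLift

/-! ## §1. The complex avatar of a quadratic-valued `𝔽_p`-character -/

section Avatar

variable (p : ℕ) [Fact p.Prime] {d : ℕ} [NeZero d]

omit [NeZero d] in
/-- A quadratic-valued character takes the values `±1` on units. [folklore] -/
theorem apply_coe_eq_one_or_eq_neg_one (ψ : DirichletCharacter (ZMod p) d)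
    (hquad : ψ.IsQuadratic) (u : (ZMod d)ˣ) : ψ (u : ZMod d) = 1 ∨ ψ (u : ZMod d) = -1 := by
  rcases hquad (u : ZMod d) with h | h | h
  · exfalso
    have hu : IsUnit (ψ (u : ZMod d)) := by
      rw [← MulChar.coe_toUnitHom]; exact Units.isUnit _
    rw [h] at hu
    exact not_isUnit_zero hu
  · exact Or.inl h
  · exact Or.inr h

omit [NeZero d] in
/-- **Every `𝔽₃`-valued Dirichlet character is quadratic-valued** (`𝔽₃ = {0, 1, −1}`). [folklore] -/
theorem isQuadratic_of_zmod_three (ψ : DirichletCharacter (ZMod 3) d) : ψ.IsQuadratic := by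
  intro a
  have h : ∀ x : ZMod 3, x = 0 ∨ x = 1 ∨ x = -1 := by decide
  exact h _

/-- **The complex avatar.** For `p ≠ 2` and a quadratic-valued `ψ : DirichletCharacter (ZMod p) d`
there are a quadratic complex character `χ` mod `d` and a sign pattern `F : ℕ → ℤ` with
`χ(b) = F(b)` and `ψ(b) = F(b) mod p` for all `b`, `χ.conductor = ψ.conductor`, and the same
parity. (GV p. 28 read `φ`, `ψ` in `ℤ_pˣ` via Teichmüller; for quadratic characters the values
`±1` live in every ring, and conductor / parity are read off the kernel `{ψ = 1}` and the value at
`−1`.) [cite: GreenbergVatsal2000, §2 p. 28 (φ, ψ viewed with values in ℤ_pˣ)]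
[cite: MontgomeryVaughan2007, §9.3 Thm. 9.13 (real primitive characters)] -/
theorem exists_complex_avatar (hp : p ≠ 2) (ψ : DirichletCharacter (ZMod p) d)
    (hquad : ψ.IsQuadratic) :
    ∃ (χ : DirichletCharacter ℂ d) (F : ℕ → ℤ), χ.IsQuadratic ∧
      (∀ b : ℕ, χ (b : ZMod d) = (F b : ℂ)) ∧
      (∀ b : ℕ, ψ (b : ZMod d) = ((F b : ℤ) : ZMod p)) ∧
      χ.conductor = ψ.conductor ∧ (ψ.Odd → χ.Odd) ∧ (ψ.Even → χ.Even) := by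
  have hm1 : (-1 : ZMod p) ≠ 1 := by
    haveI : Fact (2 < p) := ⟨lt_of_le_of_ne (Nat.Prime.two_le Fact.out) (Ne.symm hp)⟩
    exact ZMod.neg_one_ne_one
  have hval := apply_coe_eq_one_or_eq_neg_one p ψ hquad
  -- the unit hom `f(u) = if ψ(u) = 1 then 1 else −1`
  let f : (ZMod d)ˣ →* ℂˣ :=
    { toFun := fun u ↦ if ψ (u : ZMod d) = 1 then 1 else -1
      map_one' := by simp only [Units.val_one, map_one, if_true]
      map_mul' := by
        intro u v
        simp only [Units.val_mul, map_mul]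
        rcases hval u with hu | hu <;> rcases hval v with hv | hv <;> simp [hu, hv, hm1] }
  have hf : ∀ u : (ZMod d)ˣ, (f u : ℂ) = if ψ (u : ZMod d) = 1 then 1 else -1 := by
    intro u
    change (((if ψ (u : ZMod d) = 1 then 1 else -1 : ℂˣ)) : ℂ) = _
    split_ifs <;> simp
  set χ : DirichletCharacter ℂ d := MulChar.ofUnitHom f with hχdef
  have hχu : ∀ u : (ZMod d)ˣ, χ (u : ZMod d) = if ψ (u : ZMod d) = 1 then 1 else -1 := by
    intro u; rw [hχdef, MulChar.ofUnitHom_coe, hf]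
  -- the common sign pattern `F`
  let F : ℕ → ℤ := fun b ↦ if ψ (b : ZMod d) = 1 then 1 else if ψ (b : ZMod d) = -1 then -1 else 0
  have hF1 : ∀ b : ℕ, ψ (b : ZMod d) = 1 → F b = 1 := fun b h ↦ by
    simp only [F, h, if_true]
  have hFm : ∀ b : ℕ, ψ (b : ZMod d) = -1 → F b = -1 := fun b h ↦ by
    have h' : ψ (b : ZMod d) ≠ 1 := by rw [h]; exact hm1
    change (if ψ (b : ZMod d) = 1 then (1 : ℤ) else if ψ (b : ZMod d) = -1 then -1 else 0) = -1
    rw [if_neg h', if_pos h]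
  have hF0 : ∀ b : ℕ, ψ (b : ZMod d) = 0 → F b = 0 := fun b h ↦ by
    have h1 : ψ (b : ZMod d) ≠ 1 := by rw [h]; exact zero_ne_one
    have h2 : ψ (b : ZMod d) ≠ -1 := by rw [h]; exact (neg_ne_zero.mpr one_ne_zero).symm
    simp only [F, h1, h2, if_false]
  have hχF : ∀ b : ℕ, χ (b : ZMod d) = (F b : ℂ) := by
    intro b
    by_cases hb : IsUnit (b : ZMod d)
    · obtain ⟨u, hu⟩ := hb
      rcases hval u with h | h
      · have hb1 : ψ (b : ZMod d) = 1 := by rw [← hu]; exact h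
        rw [hF1 b hb1, Int.cast_one, ← hu, hχu u, if_pos h]
      · have hb2 : ψ (b : ZMod d) = -1 := by rw [← hu]; exact h
        have hne : ψ (u : ZMod d) ≠ 1 := by rw [h]; exact hm1
        rw [hFm b hb2, Int.cast_neg, Int.cast_one, ← hu, hχu u, if_neg hne]
    · rw [hF0 b (MulChar.map_nonunit _ hb), Int.cast_zero, MulChar.map_nonunit _ hb]
  have hψF : ∀ b : ℕ, ψ (b : ZMod d) = ((F b : ℤ) : ZMod p) := by
    intro b
    by_cases hb : IsUnit (b : ZMod d)
    · obtain ⟨u, hu⟩ := hb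
      rcases hval u with h | h
      · have hb1 : ψ (b : ZMod d) = 1 := by rw [← hu]; exact h
        rw [hF1 b hb1, Int.cast_one, hb1]
      · have hb2 : ψ (b : ZMod d) = -1 := by rw [← hu]; exact h
        rw [hFm b hb2, Int.cast_neg, Int.cast_one, hb2]
    · rw [hF0 b (MulChar.map_nonunit _ hb), Int.cast_zero, MulChar.map_nonunit _ hb]
  -- quadratic
  have hχq : χ.IsQuadratic := by
    intro a
    by_cases ha : IsUnit a
    · obtain ⟨u, rfl⟩ := ha
      rw [hχu u]
      split_ifs
      · exact Or.inr (Or.inl rfl)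
      · exact Or.inr (Or.inr rfl)
    · exact Or.inl (MulChar.map_nonunit _ ha)
  -- same kernel on units, hence same conductor
  have htoUnit : χ.toUnitHom = f := by
    rw [hχdef, MulChar.toUnitHom_eq, MulChar.ofUnitHom_eq, Equiv.apply_symm_apply]
  have hker : ∀ u : (ZMod d)ˣ, u ∈ χ.toUnitHom.ker ↔ u ∈ ψ.toUnitHom.ker := by
    intro u
    rw [MonoidHom.mem_ker, MonoidHom.mem_ker, htoUnit, ← Units.val_inj, ← Units.val_inj,
      MulChar.coe_toUnitHom, hf, Units.val_one, Units.val_one]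
    constructor
    · intro h
      by_contra hne
      rw [if_neg hne] at h
      norm_num at h
    · intro h
      rw [if_pos h]
  have hkerEq : χ.toUnitHom.ker = ψ.toUnitHom.ker := Subgroup.ext hker
  have hfac : ∀ n : ℕ, χ.FactorsThrough n ↔ ψ.FactorsThrough n := by
    intro n
    constructor
    · intro h
      exact (factorsThrough_iff_ker_unitsMap h.dvd).2
        (hkerEq ▸ (factorsThrough_iff_ker_unitsMap h.dvd).1 h)
    · intro h
      exact (factorsThrough_iff_ker_unitsMap h.dvd).2
        (hkerEq.symm ▸ (factorsThrough_iff_ker_unitsMap h.dvd).1 h)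
  have hcond : χ.conductor = ψ.conductor := by
    have hset : χ.conductorSet = ψ.conductorSet :=
      Set.ext fun n ↦ by rw [mem_conductorSet_iff, mem_conductorSet_iff]; exact hfac n
    unfold DirichletCharacter.conductor
    rw [hset]
  -- parity
  have hneg : ((-1 : (ZMod d)ˣ) : ZMod d) = -1 := by rw [Units.val_neg, Units.val_one]
  refine ⟨χ, F, hχq, hχF, hψF, hcond, fun hodd ↦ ?_, fun heven ↦ ?_⟩
  · rw [DirichletCharacter.Odd] at hodd ⊢
    rw [← hneg, hχu, hneg, hodd, if_neg hm1]
  · rw [DirichletCharacter.Even] at heven ⊢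
    rw [← hneg, hχu, hneg, heven, if_pos rfl]

/-- The complex avatar of a PRIMITIVE ODD quadratic-valued `ψ` is primitive, quadratic and odd with
the same sign pattern. [cite: MontgomeryVaughan2007, §9.3 Thm. 9.13] -/
theorem exists_complex_avatar_of_isPrimitive (hp : p ≠ 2) (ψ : DirichletCharacter (ZMod p) d)
    (hquad : ψ.IsQuadratic) (hprim : ψ.IsPrimitive) (hodd : ψ.Odd) :
    ∃ (χ : DirichletCharacter ℂ d) (F : ℕ → ℤ), χ.IsPrimitive ∧ χ.IsQuadratic ∧ χ.Odd ∧
      (∀ b : ℕ, b < d → χ (b : ZMod d) = (F b : ℂ)) ∧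
      (∀ b : ℕ, b < d → ψ (b : ZMod d) = ((F b : ℤ) : ZMod p)) := by
  obtain ⟨χ, F, hχq, hχF, hψF, hcond, hoddχ, -⟩ := exists_complex_avatar p hp ψ hquad
  refine ⟨χ, F, ?_, hχq, hoddχ hodd, fun b _ ↦ hχF b, fun b _ ↦ hψF b⟩
  rw [IsPrimitive, hcond]
  exact hprim

/-- **`−d` is a field discriminant**: for `p ≠ 2` and `ψ` mod `d` primitive, odd, quadratic-valued
there is an imaginary quadratic field `K` with `d_K = −d` (`−d` is a fundamental discriminant; tree
`Quadratic.exists_quadraticField_of_odd_primitive` on the avatar).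
[cite: MontgomeryVaughan2007, §9.3 Thm. 9.13] -/
theorem exists_quadraticField_discr_eq_neg (hp : p ≠ 2) (ψ : DirichletCharacter (ZMod p) d)
    (hquad : ψ.IsQuadratic) (hprim : ψ.IsPrimitive) (hodd : ψ.Odd) :
    ∃ (K : Type) (_ : Field K) (_ : NumberField K),
      Module.finrank ℚ K = 2 ∧ NumberField.discr K = -(d : ℤ) := by
  obtain ⟨χ, -, hprimχ, hχq, hoddχ, -, -⟩ := exists_complex_avatar_of_isPrimitive p hp ψ hquad hprim hodd
  exact Quadratic.exists_quadraticField_of_odd_primitive hprimχ hχq hoddχ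

end Avatar

/-! ## §2. The headline keyed on `ψ` alone -/

section Main

variable (p : ℕ) [Fact p.Prime] {d : ℕ} [NeZero d]

/-- **`‖B₁^{(d)}(ω̃ ∘ ψ⁻¹)‖_p = ‖h(−d)‖_p`** for `p ≠ 2`, `d > 4` and GV's `ψ : DirichletCharacter (ZMod p) d`
PRIMITIVE, ODD and quadratic-valued — no complex character in the hypotheses.
[cite: Washington1997, Thm. 4.17 (B_{1,χ} = −2h/w)] [cite: GreenbergVatsal2000, §3 p. 42 (27)] -/
theorem norm_twistedBernoulli_teichmullerLift_inv_eq_norm_classNumber_of_isPrimitive (hp : p ≠ 2)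
    (hd : 4 < d) (ψ : DirichletCharacter (ZMod p) d) (hquad : ψ.IsQuadratic)
    (hprim : ψ.IsPrimitive) (hodd : ψ.Odd) :
    ‖twistedBernoulli p 1 d (fun b : ℕ ↦ teichmullerLift p (ψ (b : ZMod d))⁻¹)‖ =
      ‖((BinaryQuadraticForm.classNumber (-(d : ℤ)) : ℕ) : ℚ_[p])‖ := by
  obtain ⟨χ, F, hprimχ, hχq, hoddχ, hχF, hψF⟩ :=
    exists_complex_avatar_of_isPrimitive p hp ψ hquad hprim hodd
  exact norm_twistedBernoulli_teichmullerLift_inv_eq_norm_classNumber p hp hd hprimχ hχq hoddχ ψ hχF hψF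

/-- The `C`-side shape (no inverse): `‖B₁^{(d)}(ω̃ ∘ ψ)‖_p = ‖h(−d)‖_p`, same hypotheses.
[cite: Washington1997, Thm. 4.17] [cite: GreenbergVatsal2000, §3 p. 41 (26)] -/
theorem norm_twistedBernoulli_teichmullerLift_eq_norm_classNumber_of_isPrimitive (hp : p ≠ 2)
    (hd : 4 < d) (ψ : DirichletCharacter (ZMod p) d) (hquad : ψ.IsQuadratic)
    (hprim : ψ.IsPrimitive) (hodd : ψ.Odd) :
    ‖twistedBernoulli p 1 d (fun b : ℕ ↦ teichmullerLift p (ψ (b : ZMod d)))‖ =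
      ‖((BinaryQuadraticForm.classNumber (-(d : ℤ)) : ℕ) : ℚ_[p])‖ := by
  obtain ⟨χ, F, hprimχ, hχq, hoddχ, hχF, hψF⟩ :=
    exists_complex_avatar_of_isPrimitive p hp ψ hquad hprim hodd
  exact norm_twistedBernoulli_teichmullerLift_eq_norm_classNumber p hp hd hprimχ hχq hoddχ ψ hχF hψF

/-- **`‖B₁^{(d)}(ω̃ ∘ ψ⁻¹)‖_p = 1 ↔ p ∤ h(−d)`**, keyed on `ψ` alone. [cite: Washington1997, Thm. 4.17] -/
theorem norm_twistedBernoulli_teichmullerLift_inv_eq_one_iff_of_isPrimitive (hp : p ≠ 2)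
    (hd : 4 < d) (ψ : DirichletCharacter (ZMod p) d) (hquad : ψ.IsQuadratic)
    (hprim : ψ.IsPrimitive) (hodd : ψ.Odd) :
    ‖twistedBernoulli p 1 d (fun b : ℕ ↦ teichmullerLift p (ψ (b : ZMod d))⁻¹)‖ = 1 ↔
      ¬ p ∣ BinaryQuadraticForm.classNumber (-(d : ℤ)) := by
  rw [norm_twistedBernoulli_teichmullerLift_inv_eq_norm_classNumber_of_isPrimitive p hp hd ψ hquad
      hprim hodd, Padic.norm_natCast_eq_one_iff, Nat.Prime.coprime_iff_not_dvd Fact.out]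

/-- **Field form keyed on `ψ` alone: `‖B₁^{(d)}(ω̃ ∘ ψ⁻¹)‖_p = ‖h_K‖_p`** for every `K` with
`[K : ℚ] = 2`, `d_K = −d`. [cite: Washington1997, Thm. 4.17] [cite: Cox2013, §7.B Thm. 7.7 (ii)] -/
theorem norm_twistedBernoulli_teichmullerLift_inv_eq_norm_classNumber_field_of_isPrimitive
    (hp : p ≠ 2) (hd : 4 < d) (ψ : DirichletCharacter (ZMod p) d) (hquad : ψ.IsQuadratic)
    (hprim : ψ.IsPrimitive) (hodd : ψ.Odd) (K : Type*) [Field K] [NumberField K]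
    (h2 : Module.finrank ℚ K = 2) (hK : NumberField.discr K = -(d : ℤ)) :
    ‖twistedBernoulli p 1 d (fun b : ℕ ↦ teichmullerLift p (ψ (b : ZMod d))⁻¹)‖ =
      ‖((NumberField.classNumber K : ℕ) : ℚ_[p])‖ := by
  rw [norm_twistedBernoulli_teichmullerLift_inv_eq_norm_classNumber_of_isPrimitive p hp hd ψ hquad
      hprim hodd, ← Quadratic.card_reducedForms_eq_classNumber h2 (by rw [hK]; omega), hK]

/-- **`p = 3`: `‖B₁^{(d)}(ω̃ ∘ ψ⁻¹)‖₃ = ‖h(−d)‖₃`** for every PRIMITIVE ODD `ψ : DirichletCharacter (ZMod 3) d`,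
`d > 4` (every `𝔽₃`-valued character is quadratic) — the case of LADDER row A10.
[cite: Washington1997, Thm. 4.17] [cite: GreenbergVatsal2000, §3 p. 42 (27)] -/
theorem norm_twistedBernoulli_teichmullerLift_inv_eq_norm_classNumber_three (hd : 4 < d)
    (ψ : DirichletCharacter (ZMod 3) d) (hprim : ψ.IsPrimitive) (hodd : ψ.Odd) :
    ‖twistedBernoulli 3 1 d (fun b : ℕ ↦ teichmullerLift 3 (ψ (b : ZMod d))⁻¹)‖ =
      ‖((BinaryQuadraticForm.classNumber (-(d : ℤ)) : ℕ) : ℚ_[3])‖ :=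
  norm_twistedBernoulli_teichmullerLift_inv_eq_norm_classNumber_of_isPrimitive 3 (by decide) hd ψ
    (isQuadratic_of_zmod_three ψ) hprim hodd

/-- **`p = 3`: `‖B₁^{(d)}(ω̃ ∘ ψ⁻¹)‖₃ = 1 ↔ 3 ∤ h(−d)`** for every primitive odd `ψ` mod `d > 4` with
values in `𝔽₃`. [cite: Washington1997, Thm. 4.17] -/
theorem norm_twistedBernoulli_teichmullerLift_inv_eq_one_iff_three (hd : 4 < d)
    (ψ : DirichletCharacter (ZMod 3) d) (hprim : ψ.IsPrimitive) (hodd : ψ.Odd) :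
    ‖twistedBernoulli 3 1 d (fun b : ℕ ↦ teichmullerLift 3 (ψ (b : ZMod d))⁻¹)‖ = 1 ↔
      ¬ 3 ∣ BinaryQuadraticForm.classNumber (-(d : ℤ)) :=
  norm_twistedBernoulli_teichmullerLift_inv_eq_one_iff_of_isPrimitive 3 (by decide) hd ψ
    (isQuadratic_of_zmod_three ψ) hprim hodd

end Main

/-! ## §3. `p ∤ h(−d)` ⇒ `λ(L_{Σ₀}(D, T)) = λ(L_{Σ₀}(C, T)) = 0`, keyed on `ψ` alone -/

section Lambda

variable (p : ℕ) [Fact p.Prime] {d : ℕ} [NeZero d] (S₀ : Finset (HeightOneSpectrum (𝓞 ℚ)))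

/-- **`λ(L_{Σ₀}(D, T)) = 0` from a class number, keyed on `ψ` alone**: `p ≠ 2`, `ψ` mod `d > 4`
primitive odd quadratic-valued, `ψ(p) ≠ 1`, unit Euler indicators on `Σ₀`, and `p ∤ h(−d)` ⟹
`ord_T(g mod p) = 0` for every `g ∈ Λ` interpolating GV (27).
[cite: GreenbergVatsal2000, §3 p. 42 (27)] [cite: Washington1997, Thm. 4.17]
[cite: Greenberg2001PastPresent, §4 pp. 355–356] -/
theorem order_toNat_eq_zero_of_isCharacterLFunctionD_of_not_dvd_classNumber' (hp : p ≠ 2)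
    (hd : 4 < d) (ψ : DirichletCharacter (ZMod p) d) (hquad : ψ.IsQuadratic)
    (hprim : ψ.IsPrimitive) (hodd : ψ.Odd)
    {g : IwasawaAlgebra p} (hg : IsCharacterLFunctionD p ψ S₀ g) (hψp : ψ (p : ZMod d) ≠ 1)
    (hS : ∀ v ∈ S₀, Rat.HeightOneSpectrum.natGenerator v ≠ p ∧
      ψ (Rat.HeightOneSpectrum.natGenerator v : ZMod d) ≠
        ((Rat.HeightOneSpectrum.natGenerator v : ℕ) : ZMod p))
    (hh : ¬ p ∣ BinaryQuadraticForm.classNumber (-(d : ℤ))) :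
    (PowerSeries.map (PadicInt.toZMod (p := p)) g).order.toNat = 0 :=
  order_toNat_eq_zero_of_isCharacterLFunctionD_of_units p ψ S₀ hg hp hψp hS
    ((norm_twistedBernoulli_teichmullerLift_inv_eq_one_iff_of_isPrimitive p hp hd ψ hquad hprim
      hodd).2 hh)

/-- **`λ(L_{Σ₀}(C, T)) = 0` from a class number, keyed on `ψ' = ψ⁻¹` alone** (the `C`-twin; for GV
`φ(a)·a⁻¹ = ψ'(a)` off `pℕ`). [cite: GreenbergVatsal2000, §3 p. 41 (26)] [cite: Washington1997, Thm. 4.17]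
[cite: Greenberg2001PastPresent, §4 pp. 355–356] -/
theorem order_toNat_eq_zero_of_isCharacterLFunctionC_of_not_dvd_classNumber' (hp : p ≠ 2)
    (hd : 4 < d) (ψ' : DirichletCharacter (ZMod p) d) (hquad : ψ'.IsQuadratic)
    (hprim : ψ'.IsPrimitive) (hodd : ψ'.Odd)
    {m : ℕ} (φ : DirichletCharacter (ZMod p) m) (hm : 0 < m)
    (hφψ : ∀ a : ℕ, ¬ p ∣ a → φ (a : ZMod m) * (a : ZMod p)⁻¹ = ψ' (a : ZMod d))
    {g : IwasawaAlgebra p} (hg : IsCharacterLFunctionC p φ S₀ g) (hψp : ψ' (p : ZMod d) ≠ 1)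
    (hS : ∀ v ∈ S₀, Rat.HeightOneSpectrum.natGenerator v ≠ p ∧
      ψ' (Rat.HeightOneSpectrum.natGenerator v : ZMod d) ≠ 1)
    (hh : ¬ p ∣ BinaryQuadraticForm.classNumber (-(d : ℤ))) :
    (PowerSeries.map (PadicInt.toZMod (p := p)) g).order.toNat = 0 := by
  refine order_toNat_eq_zero_of_isCharacterLFunctionC_of_units p φ S₀ ψ' hg hm hφψ hψp hS ?_
  rw [norm_twistedBernoulli_teichmullerLift_eq_norm_classNumber_of_isPrimitive p hp hd ψ' hquad hprim
      hodd, Padic.norm_natCast_eq_one_iff]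
  exact (Nat.Prime.coprime_iff_not_dvd Fact.out).2 hh

end Lambda

end Summit.BirchSwinnertonDyer.BirchSwinnertonDyer.Theorems.EisensteinPrimesMazurMCOnCellBTwistbackPartnerClassNumberLift

end
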